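import Summits.QuantumFields.YangMills.Theorems.IR.MomentumPincerNoLightMoversSC
import Summits.QuantumFields.YangMills.Theorems.IR.SCFloorSliceSums
import Summits.QuantumFields.YangMills.Theorems.IR.SCFloorSliceSpecies
import Summits.QuantumFields.YangMills.Theorems.SoloBlindSpacingPinning
import Literature.MathematicalPhysics.QuantumFieldTheory.OneLinkTraceShift

/-!
# Line `momentum-pincer` (crux `IR`, stmt-QuantumFields-19354): rung R2 — `NoLightMoversSCTransfer` — PROVED

Route `BalabanLadder`, crux `IR`, line `momentum-pincer` (ideator ym-ir-idea-5, lens RP / transfer-matrix bounds;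
skeleton `Cruxes/IR/Lines/momentum_pincer.lean` v1.6, stub `stub_noLightMoversSCTransfer : NoLightMoversSCTransfer`,
rung R2 of `Cruxes/IR/Lines/momentum-pincer-rungs.md`).  MINIMAL LANDING CUT of the crux workfile
`Cruxes/IR/Lines/momentum_pincer_R2_transfer.lean` v6 (commit 8c85df89ce78): the same theorem
`noLightMoversSCTransfer_holds`, re-based on the `SCFloor` engine's landed parts 19–20 (ym-ir-line-bsf-p1:
`sliceSum_one_floor`, `abs_sliceSum_zero_le`, `sliceSum_nonneg`, `sliceSum_logConvex`, `exists_plaquetteSpecies`)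
so that nothing is duplicated under `Theorems/IR/`.

THE ARGUMENT (Osterwalder–Seiler 1978 §2 transfer matrix; Glimm–Jaffe §6.1; typed by this line).  Let
`P = Re tr ρ(U_{(0;1,2)})` be the spatial plaquette and `s_S(t) = Σ_{x⃗ ∈ 𝕋³} Cov_{2S+1}(P∘θ_{(0,x⃗)}, P; t)` its
zero-momentum (slice-summed) time correlator on the odd torus `(ℤ/(2S+1))⁴` (`sliceSumCorr`, §0).
1. (RP / transfer matrix, engine part 20) `t ↦ s_S(t)` is `≥ 0` and log-convex on `[0, 2S+1]`; hence two-point data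
   `s_S(0) ≤ s_max`, `0 < f₁ ≤ s_S(1)` give the GEOMETRIC FLOOR `s_S(n) ≥ (f₁/s_max)^{n-1} f₁`
   (`geometric_floor_of_two_point`, tree `mulConvex_ratio_floor` + `mulConvex_lower_envelope`).
2. (strong coupling, engine part 19) `s_S(0) ≤ V` and `κ β⁴ ≤ s_S(1)` for `0 < β ≤ β₀`, ALL `S ≥ 1`; the engine's
   character hypothesis `∃ g h, Re tr ρ g ≠ Re tr ρ h` holds for every faithful unitary representation of a compact
   simple group (`LatticeRep.exists_re_trace_ne`: `N − Re tr X = ½‖X − 1‖²_F` and faithfulness).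
3. (rate ceiling, `rate_le_neg_log_of_floor`) on the window `[β₁, β₀]`, `f₁ := κ β₁⁴`, `q := f₁ / max(V, f₁)`:
   ANY valid zero-momentum clustering rate obeys `m(β) ≤ L := −log q` (floor at `t = S` against the hypothesis at
   `(P, P)`, `t = S`, `S → ∞`; tree `rate_le_of_eventually_exp_le`).
4. (assembly) with `θ := c / max(L, c)` one has `θ·m(β) ≤ c`, and R1 (`noLightMoversSC_holds`: β-uniform point
   clustering at rate `c` on `0 < β ≤ β₀`) is clustering at rate `θ·m(β)`; `S₃ := 0`.
`NoLightMoversSCTransfer`, `sliceSumCorr`, `spatialVec` below are VERBATIM copies of the skeleton's (which is not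
importable), so the stub closes BY NAME:
`theorem stub_noLightMoversSCTransfer : NoLightMoversSCTransfer := MomentumPincerRung.noLightMoversSCTransfer_holds`.

HONEST FRAMING: strong coupling only, group-blind (simplicity of `G` is used only to get some `a ≠ 1`); R2 is a
RUNG exercising the line's `p⃗ = 0 ⇒ point` transfer where the dispersion bound is computable; nothing here bears on
`IR` at weak coupling (R3, the wall), on a continuum limit, or on the Yang–Mills mass gap (Clay) — NOT proved by any
of this; R4 of the ladder closes only the conditional finite-𝕋⁴ rung `BalabanLadder.UV`.
Refs: K. Osterwalder, E. Seiler, Ann. Phys. 110 (1978) 440, §2 and Thm. 3.5; E. Seiler, LNP 159 (1982) Ch. 2;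
J. Glimm, A. Jaffe, *Quantum Physics* (1987) §6.1; cards `Cruxes/IR/Lines/momentum-pincer{,-rungs,-R2-transfer}.md`.
-/

set_option autoImplicit false

noncomputable section

open Filter Topology MeasureTheory Finset
open Literature.MathematicalPhysics.QuantumFieldTheory Literature.MathematicalPhysics.QuantumLattice
open Summit.QuantumFields.YangMills.Theorems.SoloBlind

namespace Summit.QuantumFields.YangMills.Cruxes.IR.MomentumPincerRung

variable {G : Type} [Group G] [TopologicalSpace G] [IsTopologicalGroup G] [CompactSpace G]
  [MeasurableSpace G] [BorelSpace G]

/-! ## §0 The line's objects (verbatim copies of `Cruxes/IR/Lines/momentum_pincer.lean` §1) -/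

/-- The purely spatial `ℤ⁴`-vector `(0, x⃗)` below a spatial torus site `x⃗ ∈ (ℤ/(2S+1))³` (centred representatives).
VERBATIM `Summit.QuantumFields.YangMills.Cruxes.IR.MomentumPincer.spatialVec`. -/
def spatialVec (S : ℕ) (x : Fin 3 → ZMod (2 * S + 1)) : Fin 4 → ℤ :=
  fun i => if h : i = 0 then 0 else (x (i.pred h)).valMinAbs

/-- **Zero-momentum connected time-correlation** on the torus `(2S+1)⁴` (slice sum over spatial translates of `A`
against `B` at time `t`).  VERBATIM `Summit.QuantumFields.YangMills.Cruxes.IR.MomentumPincer.sliceSumCorr`. -/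
def sliceSumCorr {N : ℕ} (ρ : G →* Matrix (Fin N) (Fin N) ℂ) (β : ℝ) (S : ℕ) (A B : LGConfig 4 G → ℝ) (t : ℕ) : ℝ :=
  ∑ x : Fin 3 → ZMod (2 * S + 1),
    latticeConnectedCorr ρ β (2 * S + 1) (fun U => A (configShift (spatialVec S x) U)) B t

/-- **R2 — `NoLightMoversSCTransfer`** (VERBATIM the body of
`Summit.QuantumFields.YangMills.Cruxes.IR.MomentumPincer.NoLightMoversSCTransfer`): on a compact strong-coupling
window `[β₁, β₀]`, zero-momentum clustering at ANY valid rate `m(β)` transfers to point clustering at rate `θ·m(β)`. -/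
def NoLightMoversSCTransfer : Prop :=
  ∀ (G : Type) [Group G] [TopologicalSpace G] [IsTopologicalGroup G] [CompactSpace G],
    IsCompactSimpleLieGroup G → letI : MeasurableSpace G := borel G; haveI : BorelSpace G := ⟨rfl⟩;
    ∀ r : LatticeRep G, ∃ β₁ β₀ θ : ℝ, 0 < β₁ ∧ β₁ < β₀ ∧ 0 < θ ∧
      ∀ (m : ℝ → ℝ) (S₁ : ℝ → ℕ), (∀ β, 0 < m β) →
        (∀ A B : YMSpecies G, ∃ C : ℝ, ∀ β : ℝ, β₁ ≤ β → β ≤ β₀ → ∀ S t : ℕ, S₁ β ≤ S → t ≤ S →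
            |sliceSumCorr r.ρ β S A.F B.F t| ≤ C * Real.exp (-(m β * t))) →
        ∃ S₃ : ℝ → ℕ, ∀ A B : YMSpecies G, ∃ C : ℝ, ∀ β : ℝ, β₁ ≤ β → β ≤ β₀ → ∀ S t : ℕ, S₃ β ≤ S → t ≤ S →
            |latticeConnectedCorr r.ρ β (2 * S + 1) A.F B.F t| ≤ C * Real.exp (-(θ * m β * t))

/-! ## §1 Two elementary real lemmas: geometric floor of a log-convex sequence; rate ceiling -/

/-- **Geometric floor from two-point data**: a non-negative multiplicatively convex sequence on `[0, K]` with
`a 0 ≤ s_max` and `0 < f₁ ≤ a 1` obeys `a n ≥ (f₁/s_max)^{n-1} f₁` for `1 ≤ n ≤ K` (`s_max > 0`).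
[elementary; tree `mulConvex_ratio_floor` + `mulConvex_lower_envelope`] -/
theorem geometric_floor_of_two_point {a : ℕ → ℝ} {K : ℕ} (h0 : ∀ k, k ≤ K → 0 ≤ a k)
    (hconv : ∀ k, k + 2 ≤ K → a (k + 1) ^ 2 ≤ a k * a (k + 2)) {sMax f₁ : ℝ} (hsMax : 0 < sMax)
    (hf : 0 < f₁) (hmax : a 0 ≤ sMax) (hfloor : f₁ ≤ a 1) :
    ∀ n, 1 ≤ n → n ≤ K → (f₁ / sMax) ^ (n - 1) * f₁ ≤ a n := by
  intro n hn hnK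
  set θ : ℝ := f₁ / sMax with hθdef
  have hθ : 0 < θ := div_pos hf hsMax
  have hfl : θ ^ (1 - 0) * a 0 ≤ a 1 := by
    rw [Nat.sub_zero, pow_one]
    calc θ * a 0 ≤ θ * sMax := mul_le_mul_of_nonneg_left hmax hθ.le
      _ = f₁ := by rw [hθdef, div_mul_cancel₀ _ hsMax.ne']
      _ ≤ a 1 := hfloor
  have hstep : ∀ q, 1 ≤ q → q + 1 ≤ K → θ * a q ≤ a (q + 1) :=
    mulConvex_ratio_floor h0 hconv hθ zero_lt_one hfl
  have henv := mulConvex_lower_envelope hθ.le hstep n hn hnK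
  calc θ ^ (n - 1) * f₁ ≤ θ ^ (n - 1) * a 1 := mul_le_mul_of_nonneg_left hfloor (pow_nonneg hθ.le _)
    _ ≤ a n := henv

/-- **Rate ceiling.**  A geometric floor against an exponential ceiling bounds the rate: if
`q^{S-1} f₁ ≤ C e^{-m S}` for all large `S` (`0 < q`, `0 < f₁`) then `m ≤ -log q`. [elementary; tree
`rate_le_of_eventually_exp_le`] -/
theorem rate_le_neg_log_of_floor {q f₁ C m : ℝ} (hq : 0 < q) (hf : 0 < f₁)
    (h : ∀ᶠ S : ℕ in atTop, q ^ (S - 1) * f₁ ≤ C * Real.exp (-(m * S))) : m ≤ -Real.log q := by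
  refine rate_le_of_eventually_exp_le (η := f₁ / q) (C := C) (u := -Real.log q) (v := m) (div_pos hf hq) ?_
  filter_upwards [h, eventually_ge_atTop 1] with S hS hS1
  have hqS : q ^ S = q * q ^ (S - 1) := by
    rw [← pow_succ']; congr 1; omega
  have hexp : Real.exp (-(-Real.log q * S)) = q ^ S := by
    rw [neg_mul, neg_neg, mul_comm, Real.exp_nat_mul, Real.exp_log hq]
  calc f₁ / q * Real.exp (-(-Real.log q * S)) = f₁ / q * (q * q ^ (S - 1)) := by rw [hexp, hqS]
    _ = q ^ (S - 1) * f₁ := by rw [← mul_assoc, div_mul_cancel₀ _ hq.ne']; ring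
    _ ≤ C * Real.exp (-(m * S)) := hS

/-! ## §2 The engine's character hypothesis holds: the real character of a faithful rep of a simple group is not constant -/

omit [IsTopologicalGroup G] [MeasurableSpace G] [BorelSpace G] in
/-- For a faithful unitary `r : LatticeRep G` of a compact simple (hence non-abelian, hence non-trivial) group the real
character `g ↦ Re tr r.ρ g` is NOT constant: `Re tr ρ(a) < N = Re tr ρ(1)` for `a ≠ 1`, by
`N − Re tr X = ½ ‖X − 1‖²_F` (tree `OneLinkTraceShift.card_sub_re_trace_eq`) and faithfulness. -/
theorem LatticeRep.exists_re_trace_ne (hG : IsCompactSimpleLieGroup G) (r : LatticeRep G) :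
    ∃ g h : G, (r.ρ g).trace.re ≠ (r.ρ h).trace.re := by
  obtain ⟨⟨_, ⟨a, b, hab⟩, _⟩, _⟩ := hG
  have ha : a ≠ 1 := by rintro rfl; simp at hab
  refine ⟨a, 1, fun h => ha ?_⟩
  have hN : (r.ρ a).trace.re = (r.N : ℝ) := by
    rw [map_one, Matrix.trace_one, Fintype.card_fin] at h
    simpa using h
  have hfrob := OneLinkTraceShift.card_sub_re_trace_eq (r.mem_unitary a)
  rw [hN, sub_self] at hfrob
  have hsq : frobNorm (r.ρ a - 1) ^ 2 = 0 := by linarith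
  rw [frobNorm_sq] at hsq
  have hzero : r.ρ a - 1 = 0 := by
    ext i j
    have hi := (Finset.sum_eq_zero_iff_of_nonneg (fun i _ => Finset.sum_nonneg fun j _ => by positivity)).1 hsq i
      (Finset.mem_univ _)
    have hij := (Finset.sum_eq_zero_iff_of_nonneg (fun j _ => by positivity)).1 hi j (Finset.mem_univ _)
    simpa using hij
  exact r.injective ((sub_eq_zero.mp hzero).trans (map_one r.ρ).symm)

/-! ## §3 R2 -/

/-- **RUNG R2 OF LINE `momentum-pincer` — PROVED.**  `NoLightMoversSCTransfer` holds: RP / transfer matrix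
(log-convexity of the plaquette slice sum, engine part 20) + the strong-coupling two-point data (engine part 19) +
the rate ceiling (§1) + R1 (`noLightMoversSC_holds`).  Window `β₀ := min(β₀^{floor}, β₀^{ceiling}, β₀^{R1})`,
`β₁ := β₀/2`, `f₁ := κ β₁⁴`, `q := f₁ / max(V, f₁)`, `θ := c / max(−log q, c)`, `S₃ := 0`. -/
theorem noLightMoversSCTransfer_holds : NoLightMoversSCTransfer := by
  intro G _ _ _ _ hG
  letI : MeasurableSpace G := borel G
  haveI : BorelSpace G := ⟨rfl⟩
  intro r
  haveI : SecondCountableTopology G :=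
    (r.continuous.isClosedEmbedding r.injective).isEmbedding.secondCountableTopology
  haveI : T2Space G := (r.continuous.isClosedEmbedding r.injective).isEmbedding.t2Space
  -- the engine: slice floor at `t = 1`, slice ceiling at `t = 0`, the plaquette species; and R1
  obtain ⟨β₀f, κ, hβ₀f, hκ, hfl⟩ :=
    SCFloor.sliceSum_one_floor r.ρ r.continuous (LatticeRep.exists_re_trace_ne hG r)
  obtain ⟨β₀z, V, hβ₀z, hV, hceil0⟩ := SCFloor.abs_sliceSum_zero_le r.ρ r.continuous
  obtain ⟨P, hPF⟩ := SCFloor.exists_plaquetteSpecies r.ρ r.continuous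
  obtain ⟨β₀R, c, hβ₀R, hc, hR1⟩ := noLightMoversSC_holds G hG r
  -- the window
  set β₀ : ℝ := min (min β₀f β₀z) β₀R with hβ₀def
  have hβ₀ : 0 < β₀ := lt_min (lt_min hβ₀f hβ₀z) hβ₀R
  set β₁ : ℝ := β₀ / 2 with hβ₁def
  have hβ₁ : 0 < β₁ := by positivity
  have hβ₁β₀ : β₁ < β₀ := by rw [hβ₁def]; linarith
  -- the constants
  set f₁ : ℝ := κ * β₁ ^ 4 with hf₁def
  have hf₁ : 0 < f₁ := by positivity
  set sMax : ℝ := max V f₁ with hsMaxdef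
  have hsMax : 0 < sMax := hf₁.trans_le (le_max_right _ _)
  set q : ℝ := f₁ / sMax with hqdef
  have hq : 0 < q := div_pos hf₁ hsMax
  set L : ℝ := -Real.log q with hLdef
  set M : ℝ := max L c with hMdef
  have hM : 0 < M := hc.trans_le (le_max_right _ _)
  set θ : ℝ := c / M with hθdef
  have hθ : 0 < θ := div_pos hc hM
  refine ⟨β₁, β₀, θ, hβ₁, hβ₁β₀, hθ, fun m S₁ hm hHyp => ⟨fun _ => 0, fun A B => ?_⟩⟩
  obtain ⟨C, hC⟩ := hR1 A B
  refine ⟨C, fun β hβ₁le hβle S t _ ht => ?_⟩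
  have hβpos : 0 < β := hβ₁.trans_le hβ₁le
  have hβR : β ≤ β₀R := hβle.trans (min_le_right _ _)
  have hβf : β ≤ β₀f := hβle.trans ((min_le_left _ _).trans (min_le_left _ _))
  have hβz : β ≤ β₀z := hβle.trans ((min_le_left _ _).trans (min_le_right _ _))
  -- RATE CEILING `m β ≤ L`: the geometric floor at `t = S'` against the hypothesis at `(P, P)`, `t = S'`
  have hmL : m β ≤ L := by
    obtain ⟨CP, hCP⟩ := hHyp P P
    rw [hPF] at hCP
    refine rate_le_neg_log_of_floor (C := CP) hq hf₁ ?_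
    filter_upwards [eventually_ge_atTop (max (S₁ β) 1)] with S' hS'
    have hS'1 : 1 ≤ S' := le_trans (le_max_right _ _) hS'
    have hS'1' : S₁ β ≤ S' := le_trans (le_max_left _ _) hS'
    -- two-point data at `β`: `s(0) ≤ V ≤ sMax`, `f₁ = κ β₁⁴ ≤ κ β⁴ ≤ s(1)`
    have h0S : sliceSumCorr r.ρ β S' (plaquetteObs r.ρ 0 1 2) (plaquetteObs r.ρ 0 1 2) 0 ≤ sMax :=
      ((le_abs_self _).trans (hceil0 S' hS'1 β hβpos.le hβz)).trans (le_max_left _ _)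
    have h1S : f₁ ≤ sliceSumCorr r.ρ β S' (plaquetteObs r.ρ 0 1 2) (plaquetteObs r.ρ 0 1 2) 1 := by
      refine le_trans ?_ (hfl S' hS'1 β hβpos hβf)
      exact mul_le_mul_of_nonneg_left (pow_le_pow_left₀ hβ₁.le hβ₁le 4) hκ.le
    have hfloor := geometric_floor_of_two_point
      (a := fun k => sliceSumCorr r.ρ β S' (plaquetteObs r.ρ 0 1 2) (plaquetteObs r.ρ 0 1 2) k) (K := 2 * S' + 1)
      (fun k _ => SCFloor.sliceSum_nonneg r.ρ r.continuous hβpos.le hS'1 k)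
      (fun k hk => SCFloor.sliceSum_logConvex r.ρ r.continuous hβpos.le hS'1 k hk)
      hsMax hf₁ h0S h1S S' hS'1 (by omega)
    have hceil := (le_abs_self _).trans (hCP β hβ₁le hβle S' S' hS'1' le_rfl)
    exact hfloor.trans hceil
  -- hence `θ · m β ≤ c`
  have hθm : θ * m β ≤ c := by
    have h1 : m β ≤ M := hmL.trans (le_max_left _ _)
    have h2 : m β / M ≤ 1 := (div_le_one hM).mpr h1
    calc θ * m β = c * (m β / M) := by rw [hθdef]; ring
      _ ≤ c * 1 := mul_le_mul_of_nonneg_left h2 hc.le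
      _ = c := mul_one c
  -- R1 and monotonicity of the exponential
  have hC0 : 0 ≤ C := by
    have h := hC β hβpos hβR 0 0 le_rfl
    simp only [Nat.cast_zero, mul_zero, neg_zero, Real.exp_zero, mul_one] at h
    exact (abs_nonneg _).trans h
  calc |latticeConnectedCorr r.ρ β (2 * S + 1) A.F B.F t| ≤ C * Real.exp (-(c * t)) := hC β hβpos hβR S t ht
    _ ≤ C * Real.exp (-(θ * m β * t)) := by
        refine mul_le_mul_of_nonneg_left (Real.exp_le_exp.mpr ?_) hC0
        have : θ * m β * t ≤ c * t := mul_le_mul_of_nonneg_right hθm (Nat.cast_nonneg t)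
        linarith

end Summit.QuantumFields.YangMills.Cruxes.IR.MomentumPincerRung

end
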